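import Literature.Topology.FourManifolds.TrisectionsSetupProfiles
import Mathlib.MeasureTheory.Integral.IntervalIntegral.FundThmCalculus
import Mathlib.Analysis.Calculus.Deriv.MeanValue
import HarnessLib

/-!
# Setting up the Morse-theoretic trisection, IV: the height profile `h₂` (a smooth clamp)

Topic `Literature/Topology/FourManifolds`; step H (part b-3, continued) of a Morse-theoretic
construction of Gay–Kirby's trisection for the fact seat
`provefact-Literature.Topology.FourManifolds.exists_isBalancedGKTrisection` (Gay–Kirby 2016,
Thm. 4 via §4, Lemma 14).  Everything in this file is **proved**; the definitions are explicit
functions of one real variable (names in the namespace `TriProfile`).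

The face `X₁ ∩ X₃` and the top height of the construction require a profile `h₂` of the Heegaard
coordinate which is **exactly affine** `-λ(t - b)` on a window around the Heegaard value `b`
(so that the sectors are linear wedges in the bi-collar box, `TwoFnData.T_box`), exactly constant
far from `b` (a positive plateau value `S_pl` below, matching the tube profile `T_P`; a negative
constant above), and **nonincreasing** throughout.  We obtain it as `h₂(t) = -λ Φ(t - b)` from the
smooth clamp `Φ(x) = ∫₀ˣ c`, `c` a smooth plateau bump (`= 1` on `[-σ, σ]`, `= 0` off
`(-5σ, 2σ)`, values in `[0, 1]`): then `Φ' = c ≥ 0`, `Φ(x) = x` on `[-σ, σ]`, `Φ` is constant off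
`(-5σ, 2σ)` with `Φ(-5σ) ∈ [-5σ, -σ]`, `Φ(2σ) ∈ [σ, 2σ]`.

* `heightBump`, `heightClamp`, `heightProfile` — the bump `c`, the clamp `Φ`, the profile `h₂`;
* `hasDerivAt_heightClamp`, `contDiff_heightClamp` — `Φ' = c`, `Φ` is smooth (fundamental theorem
  of calculus);
* `heightClamp_of_mem`, `heightClamp_of_ge`, `heightClamp_of_le` — the exact values;
* `heightProfile_*` — the design properties of `h₂` used by `BiCollar.TriSetup`: affine window,
  `h₂ b = 0`, sign on both sides of `b`, plateau value `plateauS λ σ = h₂(t ≤ b - 5σ) ∈ [λσ, 5λσ]`,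
  lower value `-bottomS λ σ` with `bottomS ∈ [λσ, 2λσ]`, `h₂' = -λ c(· - b) ≤ 0`, `h₂' = -λ` on the
  window, `|h₂| ≤ 5λσ`.

## References

* D. Gay, R. Kirby, *Trisecting 4-manifolds*, Geom. Topol. 20 (2016), §4, Lemma 14. [GayKirby2016]
-/

open scoped ContDiff Topology
open Set Function Real Filter MeasureTheory intervalIntegral

noncomputable section

namespace Literature.Topology.FourManifolds

namespace TriProfile

/-! ### The plateau bump -/

/-- **The plateau bump** `c = smoothStep (-5σ) (-σ) · stepDown σ (2σ)`. [folklore] -/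
def heightBump (σ u : ℝ) : ℝ := smoothStep (-5 * σ) (-σ) u * stepDown σ (2 * σ) u

section Bump

variable {σ : ℝ}

/-- Smooth. [folklore] -/
theorem contDiff_heightBump (σ : ℝ) : ContDiff ℝ ∞ (heightBump σ) :=
  (contDiff_smoothStep _ _).mul (contDiff_stepDown _ _)

/-- Continuous. [folklore] -/
theorem continuous_heightBump (σ : ℝ) : Continuous (heightBump σ) := (contDiff_heightBump σ).continuous

/-- Values in `[0, 1]`. [folklore] -/
theorem heightBump_mem_Icc (σ u : ℝ) : heightBump σ u ∈ Icc 0 1 := by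
  obtain ⟨h0, h1⟩ := smoothStep_mem_Icc (-5 * σ) (-σ) u
  obtain ⟨k0, k1⟩ := stepDown_mem_Icc σ (2 * σ) u
  exact ⟨mul_nonneg h0 k0, mul_le_one₀ h1 k0 k1⟩

/-- **`c = 1` on `[-σ, σ]`** (`σ > 0`). [folklore] -/
theorem heightBump_of_mem (hσ : 0 < σ) {u : ℝ} (hu : u ∈ Icc (-σ) σ) : heightBump σ u = 1 := by
  rw [heightBump, smoothStep_of_ge (by linarith) hu.1, stepDown_of_le (by linarith) hu.2, one_mul]

/-- **`c = 0` on `[2σ, ∞)`** (`σ > 0`). [folklore] -/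
theorem heightBump_of_ge (hσ : 0 < σ) {u : ℝ} (hu : 2 * σ ≤ u) : heightBump σ u = 0 := by
  rw [heightBump, stepDown_of_ge (by linarith) hu, mul_zero]

/-- **`c = 0` on `(-∞, -5σ]`** (`σ > 0`). [folklore] -/
theorem heightBump_of_le (hσ : 0 < σ) {u : ℝ} (hu : u ≤ -5 * σ) : heightBump σ u = 0 := by
  rw [heightBump, smoothStep_of_le (by linarith) hu, zero_mul]

/-- `c > 0` on `(-5σ, 2σ)` (`σ > 0`). [folklore] -/
theorem heightBump_pos (hσ : 0 < σ) {u : ℝ} (hu : u ∈ Ioo (-5 * σ) (2 * σ)) : 0 < heightBump σ u := by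
  rw [heightBump]
  refine mul_pos ?_ ?_
  · by_cases h : u < -σ
    · exact (smoothStep_mem_Ioo (by linarith) ⟨hu.1, h⟩).1
    · push Not at h; rw [smoothStep_of_ge (by linarith) h]; exact one_pos
  · by_cases h : σ < u
    · have := (smoothStep_mem_Ioo (show σ < 2 * σ by linarith) ⟨h, hu.2⟩).2
      rw [stepDown_apply]; linarith
    · push Not at h; rw [stepDown_of_le (by linarith) h]; exact one_pos

/-- The bump is interval integrable. [folklore] -/
theorem intervalIntegrable_heightBump (σ a b : ℝ) : IntervalIntegrable (heightBump σ) volume a b :=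
  (continuous_heightBump σ).intervalIntegrable a b

end Bump

/-! ### The smooth clamp -/

/-- **The smooth clamp** `Φ(x) = ∫₀ˣ c`. [folklore] -/
def heightClamp (σ x : ℝ) : ℝ := ∫ u in (0 : ℝ)..x, heightBump σ u

section Clamp

variable {σ : ℝ}

/-- **`Φ' = c`** (fundamental theorem of calculus). [folklore] -/
theorem hasDerivAt_heightClamp (σ x : ℝ) : HasDerivAt (heightClamp σ) (heightBump σ x) x :=
  ((continuous_heightBump σ).integral_hasStrictDerivAt 0 x).hasDerivAt

/-- `deriv Φ = c`. [folklore] -/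
theorem deriv_heightClamp (σ : ℝ) : deriv (heightClamp σ) = heightBump σ := funext fun x => (hasDerivAt_heightClamp σ x).deriv

/-- `Φ` is differentiable. [folklore] -/
theorem differentiable_heightClamp (σ : ℝ) : Differentiable ℝ (heightClamp σ) := fun x => (hasDerivAt_heightClamp σ x).differentiableAt

/-- **`Φ` is smooth.** [folklore] -/
theorem contDiff_heightClamp (σ : ℝ) : ContDiff ℝ ∞ (heightClamp σ) := by
  rw [contDiff_infty_iff_deriv]
  exact ⟨differentiable_heightClamp σ, by rw [deriv_heightClamp]; exact contDiff_heightBump σ⟩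

/-- `Φ 0 = 0`. [folklore] -/
theorem heightClamp_zero (σ : ℝ) : heightClamp σ 0 = 0 := by simp [heightClamp]

/-- **`Φ` is monotone** (`Φ' = c ≥ 0`). [folklore] -/
theorem monotone_heightClamp (σ : ℝ) : Monotone (heightClamp σ) :=
  monotone_of_deriv_nonneg (differentiable_heightClamp σ) fun x => by rw [deriv_heightClamp]; exact (heightBump_mem_Icc σ x).1

/-- **`Φ(x) = x` on `[-σ, σ]`** (`σ > 0`). [folklore] -/
theorem heightClamp_of_mem (hσ : 0 < σ) {x : ℝ} (hx : x ∈ Icc (-σ) σ) : heightClamp σ x = x := by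
  rw [heightClamp]
  have heq : EqOn (heightBump σ) (fun _ => (1 : ℝ)) (uIcc 0 x) := fun u hu => by
    have hu' : u ∈ Icc (-σ) σ := by
      rcases le_total 0 x with h | h
      · rw [uIcc_of_le h] at hu; exact ⟨by linarith [hu.1], hu.2.trans hx.2⟩
      · rw [uIcc_of_ge h] at hu; exact ⟨hx.1.trans hu.1, by linarith [hu.2]⟩
    exact heightBump_of_mem hσ hu'
  rw [integral_congr heq, intervalIntegral.integral_const]
  simp

/-- `Φ` splits at `y`: `Φ x = Φ y + ∫_y^x c`. [folklore] -/
theorem heightClamp_eq_add (σ y x : ℝ) : heightClamp σ x = heightClamp σ y + ∫ u in y..x, heightBump σ u := by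
  rw [heightClamp, heightClamp, integral_add_adjacent_intervals (intervalIntegrable_heightBump σ 0 y) (intervalIntegrable_heightBump σ y x)]

/-- **`Φ` is constant on `[2σ, ∞)`** (`σ > 0`). [folklore] -/
theorem heightClamp_of_ge (hσ : 0 < σ) {x : ℝ} (hx : 2 * σ ≤ x) : heightClamp σ x = heightClamp σ (2 * σ) := by
  rw [heightClamp_eq_add σ (2 * σ) x]
  have heq : EqOn (heightBump σ) (fun _ => (0 : ℝ)) (uIcc (2 * σ) x) := fun u hu => by
    rw [uIcc_of_le hx] at hu; exact heightBump_of_ge hσ hu.1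
  rw [integral_congr heq, intervalIntegral.integral_const]; simp

/-- **`Φ` is constant on `(-∞, -5σ]`** (`σ > 0`). [folklore] -/
theorem heightClamp_of_le (hσ : 0 < σ) {x : ℝ} (hx : x ≤ -5 * σ) : heightClamp σ x = heightClamp σ (-5 * σ) := by
  rw [heightClamp_eq_add σ (-5 * σ) x]
  have heq : EqOn (heightBump σ) (fun _ => (0 : ℝ)) (uIcc (-5 * σ) x) := fun u hu => by
    rw [uIcc_of_ge hx] at hu; exact heightBump_of_le hσ hu.2
  rw [integral_congr heq, intervalIntegral.integral_const]; simp

/-- **`σ ≤ Φ(2σ) ≤ 2σ`** (`σ > 0`). [folklore] -/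
theorem heightClamp_two_mul_mem (hσ : 0 < σ) : heightClamp σ (2 * σ) ∈ Icc σ (2 * σ) := by
  constructor
  · have h1 : heightClamp σ σ = σ := heightClamp_of_mem hσ ⟨by linarith, le_rfl⟩
    have := monotone_heightClamp σ (show σ ≤ 2 * σ by linarith)
    linarith
  · rw [heightClamp]
    have := intervalIntegral.integral_mono_on (show (0 : ℝ) ≤ 2 * σ by linarith) (intervalIntegrable_heightBump σ 0 (2 * σ))
      (intervalIntegrable_const (c := (1 : ℝ)) (μ := volume) (a := 0) (b := 2 * σ))
      (fun u _ => (heightBump_mem_Icc σ u).2)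
    rw [intervalIntegral.integral_const] at this
    simpa using this

/-- **`-5σ ≤ Φ(-5σ) ≤ -σ`** (`σ > 0`). [folklore] -/
theorem heightClamp_neg_five_mul_mem (hσ : 0 < σ) : heightClamp σ (-5 * σ) ∈ Icc (-5 * σ) (-σ) := by
  constructor
  · -- `Φ(-5σ) = -∫_{-5σ}^0 c ≥ -5σ`
    have hsplit := heightClamp_eq_add σ (-5 * σ) 0
    rw [heightClamp_zero] at hsplit
    have hle := intervalIntegral.integral_mono_on (show -5 * σ ≤ (0 : ℝ) by linarith) (intervalIntegrable_heightBump σ (-5 * σ) 0)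
      (intervalIntegrable_const (c := (1 : ℝ)) (μ := volume) (a := -5 * σ) (b := 0))
      (fun u _ => (heightBump_mem_Icc σ u).2)
    rw [intervalIntegral.integral_const] at hle
    have h5 : ((0 : ℝ) - -5 * σ) • (1 : ℝ) = 5 * σ := by rw [smul_eq_mul]; ring
    rw [h5] at hle
    linarith
  · have h1 : heightClamp σ (-σ) = -σ := heightClamp_of_mem hσ ⟨le_rfl, by linarith⟩
    have := monotone_heightClamp σ (show -5 * σ ≤ -σ by linarith)
    linarith

/-- **`Φ` takes values in `[Φ(-5σ), Φ(2σ)]`** (`σ > 0`). [folklore] -/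
theorem heightClamp_mem_Icc (hσ : 0 < σ) (x : ℝ) : heightClamp σ x ∈ Icc (heightClamp σ (-5 * σ)) (heightClamp σ (2 * σ)) := by
  constructor
  · by_cases h : x ≤ -5 * σ
    · rw [heightClamp_of_le hσ h]
    · push Not at h; exact monotone_heightClamp σ h.le
  · by_cases h : 2 * σ ≤ x
    · rw [heightClamp_of_ge hσ h]
    · push Not at h; exact monotone_heightClamp σ h.le

/-- `Φ x > 0` for `x > 0` (`σ > 0`). [folklore] -/
theorem heightClamp_pos (hσ : 0 < σ) {x : ℝ} (hx : 0 < x) : 0 < heightClamp σ x := by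
  by_cases h : x ≤ σ
  · rw [heightClamp_of_mem hσ ⟨by linarith, h⟩]; exact hx
  · push Not at h
    have h1 : heightClamp σ σ = σ := heightClamp_of_mem hσ ⟨by linarith, le_rfl⟩
    have := monotone_heightClamp σ h.le
    linarith

/-- `Φ x < 0` for `x < 0` (`σ > 0`). [folklore] -/
theorem heightClamp_neg (hσ : 0 < σ) {x : ℝ} (hx : x < 0) : heightClamp σ x < 0 := by
  by_cases h : -σ ≤ x
  · rw [heightClamp_of_mem hσ ⟨h, by linarith⟩]; exact hx
  · push Not at h
    have h1 : heightClamp σ (-σ) = -σ := heightClamp_of_mem hσ ⟨le_rfl, by linarith⟩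
    have := monotone_heightClamp σ h.le
    linarith

end Clamp

/-! ### The height profile `h₂` -/

/-- **The height profile** `h₂(t) = -λ Φ(t - b)`. [cite: GayKirby2016, §4, Lemma 14] -/
def heightProfile (lam σ b t : ℝ) : ℝ := -lam * heightClamp σ (t - b)

/-- **The plateau value** `S_pl = -λ Φ(-5σ)` of `h₂` (its value on `(-∞, b - 5σ]`). [folklore] -/
def plateauS (lam σ : ℝ) : ℝ := -lam * heightClamp σ (-5 * σ)

/-- **The bottom value** `S_- = λ Φ(2σ)` (`h₂ = -S_-` on `[b + 2σ, ∞)`). [folklore] -/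
def bottomS (lam σ : ℝ) : ℝ := lam * heightClamp σ (2 * σ)

section Height

variable {lam σ b : ℝ}

/-- Unfolding. [folklore] -/
theorem heightProfile_apply (lam σ b t : ℝ) : heightProfile lam σ b t = -lam * heightClamp σ (t - b) := rfl

/-- Smooth. [folklore] -/
theorem contDiff_heightProfile (lam σ b : ℝ) : ContDiff ℝ ∞ (heightProfile lam σ b) := by
  unfold heightProfile
  exact contDiff_const.mul ((contDiff_heightClamp σ).comp (contDiff_id.sub contDiff_const))

/-- **`h₂ b = 0`.** [folklore] -/
theorem heightProfile_self (lam σ b : ℝ) : heightProfile lam σ b b = 0 := by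
  rw [heightProfile_apply, sub_self, heightClamp_zero, mul_zero]

/-- **Affine on the window**: `h₂ t = -λ (t - b)` for `t ∈ [b - σ, b + σ]` (`σ > 0`). [folklore] -/
theorem heightProfile_of_mem (hσ : 0 < σ) {t : ℝ} (ht : t ∈ Icc (b - σ) (b + σ)) : heightProfile lam σ b t = -lam * (t - b) := by
  rw [heightProfile_apply, heightClamp_of_mem hσ ⟨by linarith [ht.1], by linarith [ht.2]⟩]

/-- **The plateau**: `h₂ t = S_pl` for `t ≤ b - 5σ` (`σ > 0`). [folklore] -/
theorem heightProfile_of_le (hσ : 0 < σ) {t : ℝ} (ht : t ≤ b - 5 * σ) : heightProfile lam σ b t = plateauS lam σ := by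
  rw [heightProfile_apply, plateauS, heightClamp_of_le hσ (by linarith)]

/-- **The bottom**: `h₂ t = -S_-` for `t ≥ b + 2σ` (`σ > 0`). [folklore] -/
theorem heightProfile_of_ge (hσ : 0 < σ) {t : ℝ} (ht : b + 2 * σ ≤ t) : heightProfile lam σ b t = -bottomS lam σ := by
  rw [heightProfile_apply, bottomS, heightClamp_of_ge hσ (by linarith)]; ring

/-- **`S_pl ∈ [λσ, 5λσ]`** (`λ ≥ 0`, `σ > 0`). [folklore] -/
theorem plateauS_mem (hlam : 0 ≤ lam) (hσ : 0 < σ) : plateauS lam σ ∈ Icc (lam * σ) (5 * lam * σ) := by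
  obtain ⟨h1, h2⟩ := heightClamp_neg_five_mul_mem hσ
  rw [plateauS]; constructor <;> nlinarith

/-- **`S_- ∈ [λσ, 2λσ]`** (`λ ≥ 0`, `σ > 0`). [folklore] -/
theorem bottomS_mem (hlam : 0 ≤ lam) (hσ : 0 < σ) : bottomS lam σ ∈ Icc (lam * σ) (2 * lam * σ) := by
  obtain ⟨h1, h2⟩ := heightClamp_two_mul_mem hσ
  rw [bottomS]; constructor <;> nlinarith

/-- **The range of `h₂`**: `-S_- ≤ h₂ ≤ S_pl` (`λ ≥ 0`, `σ > 0`). [folklore] -/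
theorem heightProfile_mem_Icc (hlam : 0 ≤ lam) (hσ : 0 < σ) (t : ℝ) :
    heightProfile lam σ b t ∈ Icc (-bottomS lam σ) (plateauS lam σ) := by
  obtain ⟨h1, h2⟩ := heightClamp_mem_Icc hσ (t - b)
  rw [heightProfile_apply, bottomS, plateauS]
  constructor <;> nlinarith

/-- `|h₂| ≤ 5λσ` (`λ ≥ 0`, `σ > 0`). [folklore] -/
theorem abs_heightProfile_le (hlam : 0 ≤ lam) (hσ : 0 < σ) (t : ℝ) : |heightProfile lam σ b t| ≤ 5 * lam * σ := by
  obtain ⟨h1, h2⟩ := heightProfile_mem_Icc (b := b) hlam hσ t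
  have := (plateauS_mem hlam hσ).2
  have := (bottomS_mem hlam hσ).2
  rw [abs_le]; constructor <;> nlinarith

/-- **`h₂ > 0` on `(-∞, b)`** (`λ > 0`, `σ > 0`). [folklore] -/
theorem heightProfile_pos (hlam : 0 < lam) (hσ : 0 < σ) {t : ℝ} (ht : t < b) : 0 < heightProfile lam σ b t := by
  rw [heightProfile_apply]
  have := heightClamp_neg hσ (show t - b < 0 by linarith)
  nlinarith

/-- **`h₂ < 0` on `(b, ∞)`** (`λ > 0`, `σ > 0`). [folklore] -/
theorem heightProfile_neg (hlam : 0 < lam) (hσ : 0 < σ) {t : ℝ} (ht : b < t) : heightProfile lam σ b t < 0 := by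
  rw [heightProfile_apply]
  have := heightClamp_pos hσ (show 0 < t - b by linarith)
  nlinarith

/-- **The derivative**: `h₂' t = -λ c(t - b)`. [folklore] -/
theorem hasDerivAt_heightProfile (lam σ b t : ℝ) : HasDerivAt (heightProfile lam σ b) (-lam * heightBump σ (t - b)) t := by
  have h1 : HasDerivAt (fun s : ℝ => s - b) 1 t := by simpa using (hasDerivAt_id' t).sub_const b
  have h2 := (hasDerivAt_heightClamp σ (t - b)).comp t h1
  exact (h2.const_mul (-lam)).congr_deriv (by ring)

/-- `deriv` form. [folklore] -/
theorem deriv_heightProfile (lam σ b t : ℝ) : deriv (heightProfile lam σ b) t = -lam * heightBump σ (t - b) :=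
  (hasDerivAt_heightProfile lam σ b t).deriv

/-- **`h₂' ≤ 0`** (`λ ≥ 0`). [folklore] -/
theorem deriv_heightProfile_nonpos (hlam : 0 ≤ lam) (t : ℝ) : deriv (heightProfile lam σ b) t ≤ 0 := by
  rw [deriv_heightProfile]
  have := (heightBump_mem_Icc σ (t - b)).1
  nlinarith

/-- **`h₂' < 0` on `(b - 5σ, b + 2σ)`** (`λ > 0`, `σ > 0`). [folklore] -/
theorem deriv_heightProfile_neg (hlam : 0 < lam) (hσ : 0 < σ) {t : ℝ} (ht : t ∈ Ioo (b - 5 * σ) (b + 2 * σ)) :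
    deriv (heightProfile lam σ b) t < 0 := by
  rw [deriv_heightProfile]
  have := heightBump_pos hσ (u := t - b) ⟨by linarith [ht.1], by linarith [ht.2]⟩
  nlinarith

/-- `h₂' = -λ` on the window `[b - σ, b + σ]` (`σ > 0`). [folklore] -/
theorem deriv_heightProfile_of_mem (hσ : 0 < σ) {t : ℝ} (ht : t ∈ Icc (b - σ) (b + σ)) : deriv (heightProfile lam σ b) t = -lam := by
  rw [deriv_heightProfile, heightBump_of_mem hσ ⟨by linarith [ht.1], by linarith [ht.2]⟩, mul_one]

/-- `S_pl > 0`, `S_- > 0` (`λ > 0`, `σ > 0`). [folklore] -/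
theorem plateauS_pos (hlam : 0 < lam) (hσ : 0 < σ) : 0 < plateauS lam σ ∧ 0 < bottomS lam σ :=
  ⟨lt_of_lt_of_le (mul_pos hlam hσ) (plateauS_mem hlam.le hσ).1, lt_of_lt_of_le (mul_pos hlam hσ) (bottomS_mem hlam.le hσ).1⟩

end Height

end TriProfile

end Literature.Topology.FourManifolds

end
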